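import Summits.HodgeConjecture.HodgeConjecture.Theses.TropicalKugaSatakeCayley
import Literature.AlgebraicGeometry.HodgeTheory.RationallyNormalisedDeRhamFamily
import Literature.AlgebraicGeometry.HodgeTheory.ComplexTorusHodgeClassesComparison
import Literature.Geometry.Kaehler.ComplexTorusHodgeDecomposition
import Mathlib

/-!
# Route `TropicalKugaSatakeCayley`, support S5 `CayleyHodgeRankTwo` (stmt-HodgeConjecture-18573) — part C:
# transport of constant rational `(p,p)`-forms of a torus to rational Hodge classes of an algebraic model

S5 asks, for every member `ℂ⁸/(ℤ⁸ ⊕ τ(z)ℤ⁸)` of the Kuga–Satake family and every smooth projective model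
`X` of it (`φ : ComplexTorus Φ → X(ℂ)` an analytification), for two `ℂ`-independent RATIONAL classes of
HODGE TYPE `(6,6)` in `H¹²(X(ℂ); ℂ)` — the model-layer predicates `HodgeTheory.IsRationalClass` and
`HodgeTheory.IsOfHodgeType` (existential over Hodge models). This file provides the model-layer half once
and for all (`tkc_transport_constForms`): if `γ₁, …, γ_a` are constant `k`-forms on the complex vector
space `E` (`k = p + p`) taking rational values on the `k`-tuples of lattice basis vectors `Φ(e_b)` and of
type `(p,p)` (`ComplexTorus.IsConstOfType p p`), and `ℂ`-linearly independent, then `X` carries `a`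
`ℂ`-independent rational classes of Hodge type `(p,p)` in degree `k`. With part A3 (the flatness
criterion at the cusp) this reduces S5 to exhibiting two independent integral `12`-forms on
`ℝ⁸ ⊕ ℝ⁸` killed by the ten cusp derivations (part B).

Proof: the torus is a Hodge model of `X` (carrier `ComplexTorus Φ`, comparison `φ`, a natural and
rationally normalised complex de Rham family `e` — `exists_isRational_complexDeRhamIsoFamily_holds` —
and the Hodge decomposition of the torus `ComplexTorus.isInternal_hodgePQ`); the class `e[γ]` is
rational (`IsRationalDeRhamFamily`) and lies in `H^{p,p}` (`ComplexTorus.cconstClass_mem_hodgePQ`);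
move it to `X(ℂ)` along the homeomorphism `φ` (`singularCohomology.mapIso`; rationality is preserved by
pull-backs, `IsRationalClass.pullback`), and injective linear maps preserve independence.
Theorems only: no definition, no named fact, no sorry.

## References

* [LangeBirkenhake1992] H. Lange, Ch. Birkenhake, Complex Abelian Varieties (1992), §1.1.4 Prop. 1.1.20,
  §1.1.5 Thm. 1.1.21 (cohomology of a torus = invariant forms; `H^{p,q}` = invariant `(p,q)`-forms).
* [VoisinHodgeI2002] C. Voisin, Hodge Theory and Complex Algebraic Geometry I (2002), §7.2.2, §11.3.
-/

noncomputable section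

set_option linter.dupNamespace false

namespace Summit.HodgeConjecture.HodgeConjecture.Theorems

open CategoryTheory
open Literature.AlgebraicGeometry.Tropical Literature.AlgebraicGeometry.Tropical.TropicalTorus
open Literature.Geometry.Kaehler Literature.AlgebraicGeometry.HodgeTheory
open Literature.NumberTheory.Transcendental Literature.AlgebraicTopology.SingularHomology

universe u

/-- **Transport of constant rational `(p,p)`-forms to rational Hodge classes of an algebraic model.**
Let the complex torus `T = E/Φ(ℤ^ι)` be the analytification `φ : T → X(ℂ)` of a `ℂ`-scheme `X`
(relative dimension `n`; smoothness is not needed), and let `γ₁, …, γ_a` be constant `k`-forms on `E` (`k = p + p`) which take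
RATIONAL values on the `k`-tuples of lattice basis vectors and are of type `(p,p)`. Then their classes,
moved to `Hᵏ(X(ℂ); ℂ)` along `φ`, are rational classes of Hodge type `(p,p)`, and linear independence
is preserved. Proof: the torus carries the Hodge model of `X` with a natural, rationally normalised
complex de Rham family `e` (`exists_isRational_complexDeRhamIsoFamily_holds`,
`ComplexTorus.isInternal_hodgePQ`); the class `e[γ]` is rational (`IsRationalDeRhamFamily`) and lies in
`H^{p,p}` (`ComplexTorus.cconstClass_mem_hodgePQ`); pull back along the homeomorphism `φ⁻¹`.
[cite: LangeBirkenhake1992, §1.1.4 Prop. 1.1.20 and §1.1.5 Thm. 1.1.21] [cite: VoisinHodgeI2002, §7.2.2] -/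
theorem tkc_transport_constForms {ι : Type} [Fintype ι] [DecidableEq ι]
    {E : Type} [NormedAddCommGroup E] [NormedSpace ℂ E] [FiniteDimensional ℂ E]
    (Φ : (ι → ℝ) ≃L[ℝ] E) {n : ℕ} {X : Literature.AlgebraicGeometry.Motives.SchemeOver ℂ}
    (φ : ComplexTorus Φ → Literature.AlgebraicGeometry.Motives.ComplexPoints X)
    (hφ : IsAnalytification E X n φ)
    {k p a : ℕ} (γ : Fin a → (E [⋀^Fin k]→L[ℝ] ℂ))
    (hrat : ∀ i (v : Fin k → ι), γ i (fun j => Φ (Pi.single (v j) 1)) ∈ Set.range (algebraMap ℚ ℂ))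
    (htype : ∀ i, ComplexTorus.IsConstOfType p p (γ i))
    (hli : LinearIndependent ℂ γ) :
    ∃ c : Fin a → complexBetti X k,
      (∀ i, IsRationalClass (c i)) ∧ (∀ i, IsOfHodgeType n X k p p (c i)) ∧ LinearIndependent ℂ c := by
  classical
  -- the natural, rationally normalised de Rham family and the Hodge model on the torus
  obtain ⟨e, he, hrate⟩ := exists_isRational_complexDeRhamIsoFamily_holds E
  let B : HodgeModel n X :=
    { model := E, carrier := ComplexTorus Φ, toComplexPoints := φ, isAnalytification := hφ,
      deRham := e, deRham_isNatural := he, isInternal_hodgePQ := ComplexTorus.isInternal_hodgePQ Φ }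
  -- the comparison `Hᵏ(X(ℂ); ℂ) ≅ Hᵏ(T; ℂ)` along the homeomorphism `φ`
  let hT : ComplexTorus Φ ≃ₜ Literature.AlgebraicGeometry.Motives.ComplexPoints X :=
    IsHomeomorph.homeomorph φ hφ.isHomeomorph
  let ισ := singularCohomology.mapIso (R := ℂ) (M := ℂ) hT k
  -- the linear map `forms → Hᵏ(X(ℂ); ℂ)`
  let Lq : complexBetti X k ≃ₗ[ℂ] singularCohomology ℂ ℂ (ComplexTorus Φ) k := ισ.toLinearEquiv
  let L : (E [⋀^Fin k]→L[ℝ] ℂ) →ₗ[ℂ] complexBetti X k :=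
    Lq.symm.toLinearMap ∘ₗ (e (ComplexTorus Φ) k).toLinearMap ∘ₗ ComplexTorus.cconstClass Φ
  have hL : ∀ γ' : E [⋀^Fin k]→L[ℝ] ℂ,
      L γ' = Lq.symm ((e (ComplexTorus Φ) k) (ComplexTorus.cconstClass Φ γ')) := fun _ => rfl
  have hLinj : Function.Injective L := by
    intro x y hxy
    rw [hL, hL] at hxy
    have h1 := Lq.symm.injective hxy
    have h2 := (e (ComplexTorus Φ) k).injective h1
    exact (ComplexTorus.cconstClassEquiv Φ (k := k)).injective h2
  -- `φ^*` is the comparison isomorphism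
  have hcont : (⟨φ, hφ.isHomeomorph.continuous⟩ : C(ComplexTorus Φ, Literature.AlgebraicGeometry.Motives.ComplexPoints X)) =
      (hT : C(ComplexTorus Φ, Literature.AlgebraicGeometry.Motives.ComplexPoints X)) := by
    ext x
    rfl
  have hpullback : ∀ x : complexBetti X k, B.pullback k x = Lq x := by
    intro x
    simp only [HodgeModel.pullback, Lq, Iso.toLinearEquiv_apply, ισ, singularCohomology.mapIso_hom, B, hcont]
  have hLq_symm : ∀ y, Lq.symm y = singularCohomology.map ℂ ℂ
      (hT.symm : C(Literature.AlgebraicGeometry.Motives.ComplexPoints X, ComplexTorus Φ)) k y := by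
    intro y
    simp only [Lq, Iso.toLinearEquiv_symm, Iso.toLinearEquiv_apply, Iso.symm_hom, ισ,
      singularCohomology.mapIso_inv]
  refine ⟨fun i => L (γ i), fun i => ?_, fun i => ?_, ?_⟩
  · -- rationality: `e[γ]` is rational on the torus, pull back along `φ⁻¹`
    show IsRationalClass (L (γ i))
    rw [hL, hLq_symm]
    exact IsRationalClass.pullback _ (hrate k ι Φ (γ i) (hrat i))
  · -- Hodge type through the torus model
    show IsOfHodgeType n X k p p (L (γ i))
    refine ⟨B, ?_⟩
    rw [hpullback, hL, LinearEquiv.apply_symm_apply]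
    exact Submodule.mem_map_of_mem (ComplexTorus.cconstClass_mem_hodgePQ Φ (htype i))
  · exact hli.map' L (LinearMap.ker_eq_bot.2 hLinj)

end Summit.HodgeConjecture.HodgeConjecture.Theorems

end
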